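import Summits.CriticalPhenomena.PercolationContinuityZ3.Theorems.FK.IsingPlusStateCLT
import Summits.CriticalPhenomena.PercolationContinuityZ3.Theorems.FK.IsingLocalObservableCLT
import HarnessLib

/-!
# NEWMAN'S CLT FOR LOCAL OBSERVABLES IN THE PLUS PHASE AND FOR THE ENERGY OF THE ISING MODEL:
# `|Λ_n|^{-1/2} Σ_{z∈Λ_n} Σ_i (σ_zσ_{z+e_i} − ⟨σ_0σ_{e_i}⟩) ⇒ N(0, σ_E²)` BELOW `β_c` (free state) AND FOR `β ≥ ltBeta d` (plus state)

Claimed R42 (8)(c) in the cell INBOX at 2026-08-28T18:14:08Z by fkp-10a gen 355 (NEW CLAIM #2 of the gen), addressed to coordinator fk-4 (next seated gen; (ι) in force for windows); lineage row FO-10a-g355l (self-suggested), package g355-isinglocal, label IM-E.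
Helper file of the `fk-continuity` build cell (bschramm lane; `--supports stmt-CriticalPhenomena-4575`); builds on
p205010 (kernel theorem, internal audit signed; external expert review pending). No definitions, no sorries; standard
axioms. UNCONDITIONAL except the one theorem carrying the hypothesis `hDGR` (Duminil-Copin–Goswami–Raoufi 2020, named fact).

First the companion file's generic local-observable CLT (`tendstoInDistribution_localObservable_of_summable`) in the plus state:
**`tendstoInDistribution_localObservable_plus_of_ltBeta_le`** (`d ≥ 2`, `β ≥ ltBeta d`, UNCONDITIONAL — finite susceptibility
by Friedli–Velenik Thm. 5.16) and `tendstoInDistribution_localObservable_plus_of_criticalBeta_lt` (all `β > β_c`, `d ≥ 3`,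
CONDITIONAL on `DuminilCopinGoswamiRaoufi2020_truncatedTwoPointPlus_expDecay d`). Then the energy.

Newman 1980, §1: "Theorem 2 … yields central limit theorems for the block energies (which are not monotonic) as well as
the block magnetisations". The energy density at the origin, `e = Σ_{i<d} σ_0 σ_{e_i}`, is a local observable (window
`{0, e_1, …, e_d}`), so the companion file's `tendstoInDistribution_localObservable_*` (dominated Newman CLT) applies; this
file spells the result out with the translated field written as `Σ_i σ_z σ_{z+e_i}` and the centring as the nearest-
neighbour two-point function.

* `dependsOn_energyDensity` — `Σ_i σ_0σ_{e_i}` depends only on the spins in `{0} ∪ {e_i}`.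
* `energyDensity_configShift_neg` — read at `z` it is `Σ_i σ_zσ_{z+e_i}`.
* `integral_energyDensity_free` — `E^∅_β Σ_i σ_0σ_{e_i} = Σ_i ⟨σ_0σ_{e_i}⟩^∅_β` (`twoPointFree`).
* **`tendstoInDistribution_energy_free_of_lt_criticalBeta`** — `d ≥ 2`, `0 ≤ β < β_c(d)`, free state:
  `|Λ_n|^{-1/2} (E_n − |Λ_n| Σ_i ⟨σ_0σ_{e_i}⟩^∅_β) ⇒ N(0, σ_E²)`, `E_n = Σ_{z∈Λ_n} Σ_i σ_zσ_{z+e_i}`,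
  `σ_E² = Σ_z Cov^∅_β(e, e∘θ_{−z}) ≥ 0`.
* **`tendstoInDistribution_energy_plus_of_ltBeta_le`** — `d ≥ 2`, `β ≥ ltBeta d`, plus state: the same with the plus
  expectations.

## References

* C. M. Newman, Comm. Math. Phys. 74 (1980) 119–128, §1 and Thm. 2 with the remark after (12). [Newman1980]
* S. Friedli, Y. Velenik, *Statistical Mechanics of Lattice Systems*, CUP 2017, §3.7.4, Thm. 5.16. [FriedliVelenik2017]
* H. Duminil-Copin, S. Goswami, A. Raoufi, Comm. Math. Phys. 374 (2020) 891–921, Thm. 1.1. [DuminilCopinGoswamiRaoufi2020]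
-/

noncomputable section

namespace Summit.CriticalPhenomena.PercolationContinuityZ3.Theorems.FK

namespace IsingCLT

open MeasureTheory ProbabilityTheory Filter Topology Finset
open scoped symmDiff
open Literature.Probability.Percolation Literature.Probability.LatticeModels
open Summit.CriticalPhenomena.PercolationContinuityZ3.Theorems.FK.NewmanCLT

variable {d : ℕ}

/-! ### Local observables in the plus phase -/

/-- **CLT FOR EVERY LOCAL OBSERVABLE OF THE ISING MODEL IN THE LOW-TEMPERATURE PLUS PHASE** (Newman 1980 / 1983 with
Friedli–Velenik 2017 Thm. 5.16; UNCONDITIONAL): for `d ≥ 2`, `β ≥ ltBeta d` and the plus state `μ` at zero field: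
`|Λ_n|^{-1/2} Σ_{z∈Λ_n} (f∘θ_{−z} − E⁺_β f) ⇒ N(0, Σ_z Cov⁺_β(f, f∘θ_{−z}))` for every local `f`.
[cite: Newman1980, Thm. 2 and remark after (12); FriedliVelenik2017, Thm. 5.16] -/
theorem tendstoInDistribution_localObservable_plus_of_ltBeta_le {Ω' : Type*} {mΩ' : MeasurableSpace Ω'}
    {P' : Measure Ω'} [IsProbabilityMeasure P'] {Y : Ω' → ℝ} (hd : 2 ≤ d) {β : ℝ} (hβ : LTContour.ltBeta d ≤ β)
    (μ : Measure (SpinConfig (Site d))) [IsProbabilityMeasure μ]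
    (hμ : ∀ A : Finset (Site d), spinCorr μ A = plusCorr d β 0 A) {f : SpinConfig (Site d) → ℝ}
    {D : Finset (Site d)} (hf : DependsOn f (↑D : Set (Site d))) {v : NNReal}
    (hv : (v : ℝ) = ∑' z : Site d, cov[f, fun σ => f (configShift (-z) σ); μ])
    (hY : HasLaw Y (gaussianReal 0 v) P') :
    TendstoInDistribution (fun (n : ℕ) (σ : SpinConfig (Site d)) => (Real.sqrt #(box d n))⁻¹ *
        (∑ z ∈ box d n, f (configShift (-z) σ) - #(box d n) * ∫ σ', f σ' ∂μ)) atTop Y (fun _ => μ) P' := by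
  classical
  have hβ0 : 0 ≤ β := by have := LTContour.one_le_ltBeta d; linarith
  have hT := isTranslationInvariantMeasure_of_spinCorr_eq_plusCorr hβ0 hμ
  have hsum : Summable fun z : Site d => cov[spinAt 0, spinAt z; μ] := by
    simp_rw [covariance_spinAt_eq_plusTruncated hβ0 hμ, sub_zero]
    exact summable_plusTruncated_of_ltBeta_le hd hβ
  have key := tendstoInDistribution_localObservable_of_summable (le_trans one_le_two hd)
    (isPositivelyAssociated_of_spinCorr_eq_plusCorr hβ0 0 μ hμ) hT hsum hf hv hY
  have hfm : Measurable f := hf.measurable_of_finset D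
  obtain ⟨B, hB⟩ := hf.exists_bound_of_finset D
  have hmean : ∀ n : ℕ, ∫ σ', ∑ z ∈ box d n, f (configShift (-z) σ') ∂μ = #(box d n) * ∫ σ', f σ' ∂μ := by
    intro n
    have hXm : ∀ z : Site d, Measurable fun σ : SpinConfig (Site d) => f (configShift (-z) σ) := fun z =>
      hfm.comp (configShift (-z)).measurable
    rw [integral_finsetSum _ fun z _ => integrable_of_abs_le (hXm z) (fun σ => hB _)]
    have hz : ∀ z : Site d, ∫ σ', f (configShift (-z) σ') ∂μ = ∫ σ', f σ' ∂μ := fun z => by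
      conv_rhs => rw [← hT (-z)]
      rw [integral_map_equiv]
    simp only [hz, Finset.sum_const, nsmul_eq_mul]
  simp only [hmean] at key
  exact key

/-- **CLT for every local observable in the whole ordered phase, `d ≥ 3` — CONDITIONAL on Duminil-Copin–Goswami–Raoufi
2020, Thm. 1.1** (hypothesis `hDGR`, the tree's named fact): for `β > β_c(d)` and the plus state at zero field.
[cite: Newman1980, Thm. 2; DuminilCopinGoswamiRaoufi2020, Thm 1.1] -/
theorem tendstoInDistribution_localObservable_plus_of_criticalBeta_lt {Ω' : Type*} {mΩ' : MeasurableSpace Ω'}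
    {P' : Measure Ω'} [IsProbabilityMeasure P'] {Y : Ω' → ℝ}
    (hDGR : DuminilCopinGoswamiRaoufi2020_truncatedTwoPointPlus_expDecay d) (hd : 3 ≤ d) {β : ℝ}
    (hβc : criticalBeta d < β) (μ : Measure (SpinConfig (Site d))) [IsProbabilityMeasure μ]
    (hμ : ∀ A : Finset (Site d), spinCorr μ A = plusCorr d β 0 A) {f : SpinConfig (Site d) → ℝ}
    {D : Finset (Site d)} (hf : DependsOn f (↑D : Set (Site d))) {v : NNReal}
    (hv : (v : ℝ) = ∑' z : Site d, cov[f, fun σ => f (configShift (-z) σ); μ])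
    (hY : HasLaw Y (gaussianReal 0 v) P') :
    TendstoInDistribution (fun (n : ℕ) (σ : SpinConfig (Site d)) => (Real.sqrt #(box d n))⁻¹ *
        (∑ z ∈ box d n, f (configShift (-z) σ) - #(box d n) * ∫ σ', f σ' ∂μ)) atTop Y (fun _ => μ) P' := by
  classical
  have hβ0 : 0 ≤ β := (criticalBeta_nonneg (d := d)).trans hβc.le
  have hT := isTranslationInvariantMeasure_of_spinCorr_eq_plusCorr hβ0 hμ
  have hsum : Summable fun z : Site d => cov[spinAt 0, spinAt z; μ] := by
    simp_rw [covariance_spinAt_eq_plusTruncated hβ0 hμ, sub_zero]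
    exact summable_plusTruncated_of_criticalBeta_lt hDGR hd hβc
  have key := tendstoInDistribution_localObservable_of_summable (by omega)
    (isPositivelyAssociated_of_spinCorr_eq_plusCorr hβ0 0 μ hμ) hT hsum hf hv hY
  have hfm : Measurable f := hf.measurable_of_finset D
  obtain ⟨B, hB⟩ := hf.exists_bound_of_finset D
  have hmean : ∀ n : ℕ, ∫ σ', ∑ z ∈ box d n, f (configShift (-z) σ') ∂μ = #(box d n) * ∫ σ', f σ' ∂μ := by
    intro n
    have hXm : ∀ z : Site d, Measurable fun σ : SpinConfig (Site d) => f (configShift (-z) σ) := fun z =>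
      hfm.comp (configShift (-z)).measurable
    rw [integral_finsetSum _ fun z _ => integrable_of_abs_le (hXm z) (fun σ => hB _)]
    have hz : ∀ z : Site d, ∫ σ', f (configShift (-z) σ') ∂μ = ∫ σ', f σ' ∂μ := fun z => by
      conv_rhs => rw [← hT (-z)]
      rw [integral_map_equiv]
    simp only [hz, Finset.sum_const, nsmul_eq_mul]
  simp only [hmean] at key
  exact key

/-! ### The energy density as a local observable -/

/-- **The energy density `Σ_i σ_0σ_{e_i}` depends only on the spins in the window `{0} ∪ {e_i : i < d}`.**
[cite: FriedliVelenik2017, §3.7.4] -/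
theorem dependsOn_energyDensity :
    DependsOn (fun σ : SpinConfig (Site d) => ∑ i : Fin d, spinAt 0 σ * spinAt (Pi.single i 1) σ)
      (↑(insert (0 : Site d) (Finset.univ.image fun i : Fin d => (Pi.single i 1 : Site d))) : Set (Site d)) := by
  intro σ τ h
  have h0 : σ 0 = τ 0 := h 0 (by simp)
  have hi : ∀ i : Fin d, σ (Pi.single i 1) = τ (Pi.single i 1) := fun i =>
    h _ (by simp only [Finset.coe_insert, Finset.coe_image, Finset.coe_univ, Set.image_univ, Set.mem_insert_iff,
      Set.mem_range, exists_apply_eq_apply, or_true])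
  refine Finset.sum_congr rfl fun i _ => ?_
  simp only [spinAt, h0, hi i]

/-- **Read at `z`, the energy density is `Σ_i σ_zσ_{z+e_i}`.** [folklore] -/
theorem energyDensity_configShift_neg (z : Site d) (σ : SpinConfig (Site d)) :
    (fun σ : SpinConfig (Site d) => ∑ i : Fin d, spinAt 0 σ * spinAt (Pi.single i 1) σ) (configShift (-z) σ) =
      ∑ i : Fin d, spinAt z σ * spinAt (z + Pi.single i 1) σ := by
  simp only [spinAt_configShift_neg, zero_add]
  simp only [add_comm _ z]

/-- **`E^∅_β Σ_i σ_0σ_{e_i} = Σ_i ⟨σ_0σ_{e_i}⟩^∅_β`** in the free state at zero field. [cite: FriedliVelenik2017, §3.7.4] -/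
theorem integral_energyDensity_free {β : ℝ} {μ : Measure (SpinConfig (Site d))} [IsProbabilityMeasure μ]
    (hμ : ∀ A : Finset (Site d), spinCorr μ A = freeCorr d β 0 A) :
    ∫ σ, ∑ i : Fin d, spinAt 0 σ * spinAt (Pi.single i 1) σ ∂μ = ∑ i : Fin d, twoPointFree d β (Pi.single i 1) := by
  rw [integral_finsetSum _ fun i _ => integrable_of_abs_le
    (show Measurable (fun σ : SpinConfig (Site d) => spinAt 0 σ * spinAt (Pi.single i 1) σ) from
      (measurable_spinAt 0).mul (measurable_spinAt _))
    (fun σ => by rw [abs_mul, abs_spinAt, abs_spinAt, one_mul])]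
  exact Finset.sum_congr rfl fun i _ => integral_spinAt_mul_spinAt_eq_twoPointFree hμ _

/-- **`E⁺ Σ_i σ_0σ_{e_i} = Σ_i ⟨σ_{{0}∆{e_i}}⟩⁺_{β,h}`** in the plus state. [cite: FriedliVelenik2017, Thm. 3.17] -/
theorem integral_energyDensity_plus {β h : ℝ} {μ : Measure (SpinConfig (Site d))} [IsProbabilityMeasure μ]
    (hμ : ∀ A : Finset (Site d), spinCorr μ A = plusCorr d β h A) :
    ∫ σ, ∑ i : Fin d, spinAt 0 σ * spinAt (Pi.single i 1) σ ∂μ =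
      ∑ i : Fin d, plusCorr d β h ({0} ∆ {(Pi.single i 1 : Site d)}) := by
  rw [integral_finsetSum _ fun i _ => integrable_of_abs_le
    (show Measurable (fun σ : SpinConfig (Site d) => spinAt 0 σ * spinAt (Pi.single i 1) σ) from
      (measurable_spinAt 0).mul (measurable_spinAt _))
    (fun σ => by rw [abs_mul, abs_spinAt, abs_spinAt, one_mul])]
  exact Finset.sum_congr rfl fun i _ => integral_spinAt_mul_spinAt_eq_plusCorr hμ _

/-! ### The energy CLT -/

/-- **CENTRAL LIMIT THEOREM FOR THE ISING ENERGY BELOW `β_c`** (Newman 1980, §1 + Thm. 2 with the remark after (12) — the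
energy is NOT monotone but is dominated by the local magnetisation; finite susceptibility by sharpness; UNCONDITIONAL):
for `d ≥ 2`, `0 ≤ β < β_c(d)` and the free state `μ` at zero field (`∫ σ_A dμ = ⟨σ_A⟩^∅_{β,0}`), with
`E_n = Σ_{z∈Λ_n} Σ_{i<d} σ_z σ_{z+e_i}` (the energy of the bonds issuing from `Λ_n` in the positive directions):

`(E_n − |Λ_n| Σ_i ⟨σ_0σ_{e_i}⟩^∅_β) / √|Λ_n| → N(0, σ_E²)` in distribution, `σ_E² = Σ_{z∈ℤ^d} Cov^∅_β(e, e∘θ_{−z})`,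

`e = Σ_i σ_0σ_{e_i}` (for any `Y ~ gaussianReal 0 σ_E²`; `σ_E² ≥ 0` and summable by
`tsum_cov_localObservable_shift_nonneg`, `summable_cov_localObservable_shift`).
[cite: Newman1980, §1 and Thm. 2; AizenmanBarskyFernandezJSP1987, Thm. 1] -/
theorem tendstoInDistribution_energy_free_of_lt_criticalBeta {Ω' : Type*} {mΩ' : MeasurableSpace Ω'}
    {P' : Measure Ω'} [IsProbabilityMeasure P'] {Y : Ω' → ℝ} (hd : 2 ≤ d) {β : ℝ} (hβ : 0 ≤ β)
    (hβc : β < criticalBeta d) (μ : Measure (SpinConfig (Site d))) [IsProbabilityMeasure μ]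
    (hμ : ∀ A : Finset (Site d), spinCorr μ A = freeCorr d β 0 A) {v : NNReal}
    (hv : (v : ℝ) = ∑' z : Site d, cov[fun σ => ∑ i : Fin d, spinAt 0 σ * spinAt (Pi.single i 1) σ,
      fun σ => (fun σ : SpinConfig (Site d) => ∑ i : Fin d, spinAt 0 σ * spinAt (Pi.single i 1) σ)
        (configShift (-z) σ); μ])
    (hY : HasLaw Y (gaussianReal 0 v) P') :
    TendstoInDistribution (fun (n : ℕ) (σ : SpinConfig (Site d)) => (Real.sqrt #(box d n))⁻¹ *
        (∑ z ∈ box d n, ∑ i : Fin d, spinAt z σ * spinAt (z + Pi.single i 1) σ -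
          #(box d n) * ∑ i : Fin d, twoPointFree d β (Pi.single i 1))) atTop Y (fun _ => μ) P' := by
  have key := tendstoInDistribution_localObservable_free_of_lt_criticalBeta hd hβ hβc μ hμ dependsOn_energyDensity hv hY
  simp only [energyDensity_configShift_neg, integral_energyDensity_free hμ] at key
  exact key

/-- **CENTRAL LIMIT THEOREM FOR THE ISING ENERGY IN THE LOW-TEMPERATURE PLUS PHASE** (Newman 1980, §1; Friedli–Velenik
2017, Thm. 5.16 for the finite susceptibility; UNCONDITIONAL): for `d ≥ 2`, `β ≥ ltBeta d` and the plus state `μ` at zero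
field: `(E_n − |Λ_n| Σ_i ⟨σ_0σ_{e_i}⟩⁺_β)/√|Λ_n| ⇒ N(0, Σ_z Cov⁺_β(e, e∘θ_{−z}))`.
[cite: Newman1980, §1 and Thm. 2; FriedliVelenik2017, Thm. 5.16] -/
theorem tendstoInDistribution_energy_plus_of_ltBeta_le {Ω' : Type*} {mΩ' : MeasurableSpace Ω'}
    {P' : Measure Ω'} [IsProbabilityMeasure P'] {Y : Ω' → ℝ} (hd : 2 ≤ d) {β : ℝ} (hβ : LTContour.ltBeta d ≤ β)
    (μ : Measure (SpinConfig (Site d))) [IsProbabilityMeasure μ]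
    (hμ : ∀ A : Finset (Site d), spinCorr μ A = plusCorr d β 0 A) {v : NNReal}
    (hv : (v : ℝ) = ∑' z : Site d, cov[fun σ => ∑ i : Fin d, spinAt 0 σ * spinAt (Pi.single i 1) σ,
      fun σ => (fun σ : SpinConfig (Site d) => ∑ i : Fin d, spinAt 0 σ * spinAt (Pi.single i 1) σ)
        (configShift (-z) σ); μ])
    (hY : HasLaw Y (gaussianReal 0 v) P') :
    TendstoInDistribution (fun (n : ℕ) (σ : SpinConfig (Site d)) => (Real.sqrt #(box d n))⁻¹ *
        (∑ z ∈ box d n, ∑ i : Fin d, spinAt z σ * spinAt (z + Pi.single i 1) σ -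
          #(box d n) * ∑ i : Fin d, plusCorr d β 0 ({0} ∆ {(Pi.single i 1 : Site d)}))) atTop Y (fun _ => μ) P' := by
  have key := tendstoInDistribution_localObservable_plus_of_ltBeta_le hd hβ μ hμ dependsOn_energyDensity hv hY
  simp only [energyDensity_configShift_neg, integral_energyDensity_plus hμ] at key
  exact key

/-- **The energy CLT variance is well defined and nonnegative below `β_c`**: `z ↦ Cov^∅_β(e, e∘θ_{−z})` is summable and
its sum is `≥ 0` (so `v := ⟨σ_E², ·⟩ : ℝ≥0` instantiates `hv`). [cite: Newman1980, Thm. 2 (D) and (12)] -/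
theorem summable_cov_energy_free_of_lt_criticalBeta (hd : 2 ≤ d) {β : ℝ} (hβ : 0 ≤ β) (hβc : β < criticalBeta d)
    (μ : Measure (SpinConfig (Site d))) [IsProbabilityMeasure μ]
    (hμ : ∀ A : Finset (Site d), spinCorr μ A = freeCorr d β 0 A) :
    Summable (fun z : Site d => cov[fun σ => ∑ i : Fin d, spinAt 0 σ * spinAt (Pi.single i 1) σ,
      fun σ => (fun σ : SpinConfig (Site d) => ∑ i : Fin d, spinAt 0 σ * spinAt (Pi.single i 1) σ)
        (configShift (-z) σ); μ]) ∧
    0 ≤ ∑' z : Site d, cov[fun σ => ∑ i : Fin d, spinAt 0 σ * spinAt (Pi.single i 1) σ,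
      fun σ => (fun σ : SpinConfig (Site d) => ∑ i : Fin d, spinAt 0 σ * spinAt (Pi.single i 1) σ)
        (configShift (-z) σ); μ] := by
  have hPA := isPositivelyAssociated_of_spinCorr_eq_freeCorr hβ le_rfl μ hμ
  have hT := isTranslationInvariantMeasure_of_spinCorr_eq_freeCorr hβ le_rfl μ hμ
  have hsum : Summable fun z : Site d => cov[spinAt 0, spinAt z; μ] := by
    simp_rw [covariance_spinAt_eq_twoPointFree hβ hμ, sub_zero]
    exact summable_twoPointFree_of_lt_criticalBeta hd hβ hβc
  exact ⟨summable_cov_localObservable_shift hPA hT hsum dependsOn_energyDensity,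
    tsum_cov_localObservable_shift_nonneg hPA hT hsum dependsOn_energyDensity⟩

end IsingCLT

end Summit.CriticalPhenomena.PercolationContinuityZ3.Theorems.FK

end
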